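import Mathlib

/-!
# `LieRankDesigns` (stmt-MatrixMultiplication-7614), line `fixed-rank-universality-gl2-level-one`: stub A `stub_evalCriterion` — the evaluation criterion

Crux `Summit.MatrixMultiplication.MatrixMultiplication.Theses.LevelGradedCohnUmans.LieRankDesigns`;
line `fixed-rank-universality-gl2-level-one` reduces the crux to level-one designs decided by an
exact linear oracle, and this file proves the registered stub `stub_evalCriterion` verbatim
(name + signature) — the abstract finite-dimensional duality behind that oracle (the sufficiency
half; the necessity half is the tree's `LevelTwoBeatsCubes.Negative.card_add_card_le_finrank`) —
and lands `--supports stmt-MatrixMultiplication-7614`.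

Statement.  `G` a finite type, `J ≤ ℂ^G` a subspace, `ev_g := (LinearMap.proj g).comp J.subtype`
the evaluation-at-`g` functional restricted to `J`.  If the family `(ev_{t i})_i` is linearly
independent and `span {ev_{t i}} ⊓ span {ev_s : s ∈ S} = ⊥`, then for each `i` there is
`f ∈ J` with `f (t i) = 1`, `f (t j) = 0` for `j ≠ i`, and `f s = 0` for `s ∈ S`.

Proof.  Put `W := span (ev_{t j} : j ≠ i) ⊔ span (ev_s : s ∈ S) ≤ Dual J`.  Then `ev_{t i} ∉ W`:
if `ev_{t i} = a + b` with `a ∈ span (others)`, `b ∈ span (ev_S)`, then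
`b = ev_{t i} - a ∈ span (range ev_t) ⊓ span (ev_S) = ⊥`, so `ev_{t i} = a`, contradicting
linear independence (`LinearIndependent.notMem_span_image`).  `J` is finite-dimensional over
`ℂ`, hence so is `Dual J`, and `Submodule.exists_dual_map_eq_bot_of_notMem` yields a functional
`φ` on `Dual J` killing `W` with `φ (ev_{t i}) ≠ 0`; rescale to `φ (ev_{t i}) = 1` and pull back
through `Module.evalEquiv ℂ J : J ≃ Dual (Dual J)` to an `f ∈ J` with `ψ f = φ ψ` for every
`ψ ∈ Dual J` (`Module.apply_evalEquiv_symm_apply`); taking `ψ := ev_g` gives `f g = φ (ev_g)`.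
-/

set_option linter.dupNamespace false

noncomputable section

namespace Summit.MatrixMultiplication.MatrixMultiplication.Theorems.LieRankDesigns

namespace EvalCriterion

variable {G : Type} {J : Submodule ℂ (G → ℂ)}

/-- Absorbing the `S`-part: if the restricted evaluations `(ev_{t i})_i` are linearly independent
and their span meets `span (ev '' S)` trivially, then `ev_{t i}` is not in
`span (ev_{t j} : j ≠ i) ⊔ span (ev '' S)`. -/
theorem ev_notMem_sup {ι : Type} (t : ι → G) (S : Set G)
    (hli : LinearIndependent ℂ fun i => ((LinearMap.proj (t i)).comp J.subtype : Module.Dual ℂ J))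
    (hdisj : Disjoint
      (Submodule.span ℂ (Set.range fun i => ((LinearMap.proj (t i)).comp J.subtype : Module.Dual ℂ J)))
      (Submodule.span ℂ ((fun g => ((LinearMap.proj g).comp J.subtype : Module.Dual ℂ J)) '' S)))
    (i : ι) :
    ((LinearMap.proj (t i)).comp J.subtype : Module.Dual ℂ J) ∉
      Submodule.span ℂ ((fun j => ((LinearMap.proj (t j)).comp J.subtype : Module.Dual ℂ J)) ''
          {j | j ≠ i}) ⊔
        Submodule.span ℂ ((fun g => ((LinearMap.proj g).comp J.subtype : Module.Dual ℂ J)) '' S) := by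
  intro hmem
  rw [Submodule.mem_sup] at hmem
  obtain ⟨a, ha, b, hb, hab⟩ := hmem
  have hb' : b ∈ Submodule.span ℂ
      (Set.range fun j => ((LinearMap.proj (t j)).comp J.subtype : Module.Dual ℂ J)) := by
    rw [eq_sub_of_add_eq' hab]
    exact Submodule.sub_mem _ (Submodule.subset_span ⟨i, rfl⟩)
      (Submodule.span_mono (Set.image_subset_range _ _) ha)
  have hb0 : b = 0 := (Submodule.disjoint_def.mp hdisj) b hb' hb
  rw [hb0, add_zero] at hab
  rw [hab] at ha
  exact hli.notMem_span_image (s := {j | j ≠ i}) (fun h => h rfl) ha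

/-- Finite-dimensional duality: a vector `x` of `Dual J` outside a subspace `W` is separated from
`W` by an element `f ∈ J` (through `J ≃ Dual (Dual J)`, `Module.evalEquiv`), normalised so that
`x f = 1`. -/
theorem exists_mem_eval_eq_one_of_notMem [Fintype G] (W : Submodule ℂ (Module.Dual ℂ J))
    {x : Module.Dual ℂ J} (hx : x ∉ W) :
    ∃ f : J, x f = 1 ∧ ∀ w ∈ W, w f = 0 := by
  obtain ⟨φ, hφx, hφW⟩ := Submodule.exists_dual_map_eq_bot_of_notMem hx inferInstance
  refine ⟨(Module.evalEquiv ℂ J).symm ((φ x)⁻¹ • φ), ?_, fun w hw => ?_⟩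
  · rw [Module.apply_evalEquiv_symm_apply, LinearMap.smul_apply, smul_eq_mul,
      inv_mul_cancel₀ hφx]
  · have hw0 : φ w = 0 := by
      have h : φ w ∈ Submodule.map φ W := Submodule.mem_map_of_mem hw
      rwa [hφW, Submodule.mem_bot] at h
    rw [Module.apply_evalEquiv_symm_apply, LinearMap.smul_apply, smul_eq_mul, hw0, mul_zero]

end EvalCriterion

open EvalCriterion in
/-- **Evaluation criterion** (registered stub A of line `fixed-rank-universality-gl2-level-one`):
for a finite type `G`, a subspace `J ≤ ℂ^G`, a family `t : ι → G` whose restricted evaluation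
functionals `ev_{t i} ∈ Dual J` are linearly independent with span disjoint from
`span {ev_s : s ∈ S}`, every `i` admits `f ∈ J` with `f (t i) = 1`, `f (t j) = 0 (j ≠ i)` and
`f|_S = 0`. -/
theorem stub_evalCriterion :
    ∀ (G : Type) [Fintype G] (J : Submodule ℂ (G → ℂ)) (ι : Type) (t : ι → G) (S : Set G),
      LinearIndependent ℂ (fun i => ((LinearMap.proj (t i)).comp J.subtype : Module.Dual ℂ J)) →
      Disjoint (Submodule.span ℂ (Set.range fun i => ((LinearMap.proj (t i)).comp J.subtype : Module.Dual ℂ J)))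
        (Submodule.span ℂ ((fun g => ((LinearMap.proj g).comp J.subtype : Module.Dual ℂ J)) '' S)) →
      ∀ i : ι, ∃ f ∈ J, f (t i) = 1 ∧ (∀ j : ι, j ≠ i → f (t j) = 0) ∧ ∀ s ∈ S, f s = 0 := by
  intro G _ J ι t S hli hdisj i
  obtain ⟨f, hf1, hfW⟩ := exists_mem_eval_eq_one_of_notMem _ (ev_notMem_sup t S hli hdisj i)
  refine ⟨f, f.2, hf1, fun j hj => ?_, fun s hs => ?_⟩
  · exact hfW _ (Submodule.mem_sup_left (Submodule.subset_span ⟨j, hj, rfl⟩))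
  · exact hfW _ (Submodule.mem_sup_right (Submodule.subset_span ⟨s, hs, rfl⟩))

end Summit.MatrixMultiplication.MatrixMultiplication.Theorems.LieRankDesigns

end
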